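import Summits.CriticalPhenomena.PercolationContinuityZ3.Theorems.PercNearOneGluingNoHeavyLowerTailKnQuestion8CoefficientwiseGluing
import Summits.CriticalPhenomena.PercolationContinuityZ3.Theorems.PercNearOneGluingNoHeavyLowerTailDualBHKBlock
import HarnessLib

/-!
# THEOREM SP (a) in concrete form: the coefficientwise first rung is closed under PARALLEL composition; base cases

Support file (`--supports stmt-CriticalPhenomena-4575`, closed), prover `prim-lf-2` (gen 26).  No definitions, no named facts, no sorries; standard axioms.
Memo `prim-lf-2/CW-MARTINGALE-gen25.md` §4.3 and §8 (a); abstract kernel version `Coefficientwise.kernel_tensor` (`…CoefficientwiseTensor.lean`, gen 25);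
bookkeeping `…CoefficientwiseGluing.lean`; companions `…CoefficientwiseSeries.lean` (SP (b)), `…CoefficientwiseDecoration.lean` (SP (c)).

The class `𝒞`: `(E; x, z) ∈ 𝒞` iff for all monotone `f, g : Set V → ℝ`
  `0 ≤ Σ_{s ⊆ E : z ∉ C_x(s), z ∉ C_x(E∖s)} (f(C_x s) − f(C_x(E∖s)))·(g(C_x s) − g(C_x(E∖s)))`   (`C_x(s) = openCluster (ends '' s) x`).

* `Coefficientwise.sum_powerset_filter_sdiff` — colour-swap reindexing on a swap-invariant sub-event of the colourings of `E`.
* `Coefficientwise.cwpa_asymm` — the symmetric form above is twice the asymmetric form `Σ φ(K)(ψ(K) − ψ(K̄))`; both asymmetric forms are `≥ 0` on `𝒞`.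
* `Coefficientwise.cwpa_parallel` — **THEOREM SP (a)**: if `E₁, E₂` are disjoint edge sets whose edges can only share the vertices `x, z`, and `(E₁; x, z)`,
  `(E₂; x, z) ∈ 𝒞`, then `(E₁ ∪ E₂; x, z) ∈ 𝒞`.  (Under the wall the clusters are unions `K₁ ∪ K₂`, `K̄₁ ∪ K̄₂` of independent pieces
  (`mem_openCluster_union_parallel`); expand `(f(K₁∪K₂) − f(K̄₁∪K̄₂))(g(K₁∪K₂) − g(K̄₁∪K̄₂))` into four asymmetric terms, each signed by `cwpa_asymm` on one
  piece with the other piece frozen — the tensorisation argument of `kernel_tensor`.)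
* Base cases: `Coefficientwise.cwpa_of_not_mem_openCluster` (terminals not joined inside `E`: the wall is everything, Harris), `Coefficientwise.cwpa_of_adj`
  (an `x–z` edge in `E`: the wall is empty); `Coefficientwise.cwpa_univ_of_powerset` / `cwpa_powerset_of_univ` (translation between the `E = univ`
  powerset form and the `sᶜ` form of `Coefficientwise.cwpa_pendant_symm`).
Together with SP (b), (c) these generate, from single edges, every two-terminal series–parallel network with pendant decorations (THEOREM SP of the memo).
[cite: KozmaNitzan2024, Questions 8–9 (§5.5 p. 36) (context: first rung of the coefficientwise programme for Question 8)]
-/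

namespace Summit.CriticalPhenomena.PercolationContinuityZ3.Theorems

open Finset Literature.Probability.Percolation

namespace Coefficientwise

variable {ι V : Type*} [DecidableEq ι]

/-- Colour-swap reindexing on a swap-invariant sub-event `Q` of the colourings of `E`: `Σ_{s ⊆ E, Q s} H(E∖s) = Σ_{s ⊆ E, Q s} H(s)`.
[cite: KozmaNitzan2024, §5.5 (context only; folklore)] -/
theorem sum_powerset_filter_sdiff (E : Finset ι) (Q : Finset ι → Prop) [DecidablePred Q]
    (hQ : ∀ s, s ⊆ E → (Q (E \ s) ↔ Q s)) (H : Finset ι → ℝ) :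
    ∑ s ∈ E.powerset.filter Q, H (E \ s) = ∑ s ∈ E.powerset.filter Q, H s := by
  refine Finset.sum_bij' (fun s _ => E \ s) (fun s _ => E \ s) ?_ ?_ ?_ ?_ ?_
  · intro s hs
    rw [Finset.mem_filter] at hs ⊢
    exact ⟨Finset.mem_powerset.mpr Finset.sdiff_subset, (hQ s (Finset.mem_powerset.mp hs.1)).mpr hs.2⟩
  · intro s hs
    rw [Finset.mem_filter] at hs ⊢
    exact ⟨Finset.mem_powerset.mpr Finset.sdiff_subset, (hQ s (Finset.mem_powerset.mp hs.1)).mpr hs.2⟩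
  · intro s hs; exact Finset.sdiff_sdiff_eq_self (Finset.mem_powerset.mp (Finset.mem_filter.mp hs).1)
  · intro s hs; exact Finset.sdiff_sdiff_eq_self (Finset.mem_powerset.mp (Finset.mem_filter.mp hs).1)
  · intro s _; rfl

open Classical in
/-- **Asymmetric forms.**  If `(E; x, z) ∈ 𝒞` (symmetric form, all monotone `φ, ψ`), then for monotone `φ, ψ` both
`0 ≤ Σ_{wall} φ(K)(ψ(K) − ψ(K̄))` and `0 ≤ Σ_{wall} φ(K̄)(ψ(K̄) − ψ(K))` (`K = C_x(s)`, `K̄ = C_x(E∖s)`): the symmetric form is their sum and the colour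
swap `s ↦ E∖s` shows they are equal.  [cite: KozmaNitzan2024, §5.5 (context only)] -/
theorem cwpa_asymm (ends : ι → Sym2 V) (E : Finset ι) (x z : V)
    (h : ∀ φ ψ : Set V → ℝ, Monotone φ → Monotone ψ →
      0 ≤ ∑ s ∈ E.powerset.filter (fun s : Finset ι => z ∉ openCluster (ends '' (↑s : Set ι)) x ∧
            z ∉ openCluster (ends '' (↑(E \ s) : Set ι)) x),
        (φ (openCluster (ends '' (↑s : Set ι)) x) - φ (openCluster (ends '' (↑(E \ s) : Set ι)) x)) *
          (ψ (openCluster (ends '' (↑s : Set ι)) x) - ψ (openCluster (ends '' (↑(E \ s) : Set ι)) x)))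
    (φ ψ : Set V → ℝ) (hφ : Monotone φ) (hψ : Monotone ψ) :
    0 ≤ ∑ s ∈ E.powerset.filter (fun s : Finset ι => z ∉ openCluster (ends '' (↑s : Set ι)) x ∧
            z ∉ openCluster (ends '' (↑(E \ s) : Set ι)) x),
        φ (openCluster (ends '' (↑s : Set ι)) x) *
          (ψ (openCluster (ends '' (↑s : Set ι)) x) - ψ (openCluster (ends '' (↑(E \ s) : Set ι)) x)) ∧
    0 ≤ ∑ s ∈ E.powerset.filter (fun s : Finset ι => z ∉ openCluster (ends '' (↑s : Set ι)) x ∧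
            z ∉ openCluster (ends '' (↑(E \ s) : Set ι)) x),
        φ (openCluster (ends '' (↑(E \ s) : Set ι)) x) *
          (ψ (openCluster (ends '' (↑(E \ s) : Set ι)) x) - ψ (openCluster (ends '' (↑s : Set ι)) x)) := by
  set K : Finset ι → Set V := fun s => openCluster (ends '' (↑s : Set ι)) x with hK
  set S : Finset (Finset ι) := E.powerset.filter (fun s => z ∉ K s ∧ z ∉ K (E \ s)) with hS
  change 0 ≤ ∑ s ∈ S, φ (K s) * (ψ (K s) - ψ (K (E \ s))) ∧ 0 ≤ ∑ s ∈ S, φ (K (E \ s)) * (ψ (K (E \ s)) - ψ (K s))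
  have h' : 0 ≤ ∑ s ∈ S, (φ (K s) - φ (K (E \ s))) * (ψ (K s) - ψ (K (E \ s))) := h φ ψ hφ hψ
  have hsplit : ∑ s ∈ S, (φ (K s) - φ (K (E \ s))) * (ψ (K s) - ψ (K (E \ s))) =
      ∑ s ∈ S, φ (K s) * (ψ (K s) - ψ (K (E \ s))) + ∑ s ∈ S, φ (K (E \ s)) * (ψ (K (E \ s)) - ψ (K s)) := by
    rw [← Finset.sum_add_distrib]
    exact Finset.sum_congr rfl fun s _ => by ring
  have hswap : ∑ s ∈ S, φ (K (E \ s)) * (ψ (K (E \ s)) - ψ (K s)) = ∑ s ∈ S, φ (K s) * (ψ (K s) - ψ (K (E \ s))) := by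
    have e1 : ∑ s ∈ S, φ (K (E \ s)) * (ψ (K (E \ s)) - ψ (K s)) =
        ∑ s ∈ S, φ (K (E \ s)) * (ψ (K (E \ s)) - ψ (K (E \ (E \ s)))) := by
      refine Finset.sum_congr rfl fun s hs => ?_
      rw [Finset.sdiff_sdiff_eq_self (Finset.mem_powerset.mp (Finset.mem_filter.mp hs).1)]
    rw [e1]
    exact sum_powerset_filter_sdiff E (fun s => z ∉ K s ∧ z ∉ K (E \ s))
      (fun s hs => by rw [Finset.sdiff_sdiff_eq_self hs]; exact and_comm) (fun s => φ (K s) * (ψ (K s) - ψ (K (E \ s))))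
  rw [hsplit, hswap] at h'
  constructor
  · linarith
  · rw [hswap]; linarith

open Classical in
/-- **THEOREM SP (a) — parallel composition** (memo `prim-lf-2/CW-MARTINGALE-gen25.md` §4.3, §8 (a)).  Let `E₁, E₂ ⊆ ι` be disjoint edge sets of a
finite multigraph `ends : ι → Sym2 V` such that an `E₁`-edge and an `E₂`-edge can only share the vertices `x` and `z`.  If `(E₁; x, z)` and `(E₂; x, z)`
satisfy the coefficientwise first rung (for all monotone `φ, ψ`), then so does `(E₁ ∪ E₂; x, z)`.
[cite: KozmaNitzan2024, Questions 8–9 (§5.5 p. 36) (context)] -/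
theorem cwpa_parallel (ends : ι → Sym2 V) {E₁ E₂ : Finset ι} (hE : Disjoint E₁ E₂) {x z : V}
    (hsep : ∀ e ∈ E₁, ∀ e' ∈ E₂, ∀ w : V, w ∈ ends e → w ∈ ends e' → w = x ∨ w = z)
    (h₁ : ∀ φ ψ : Set V → ℝ, Monotone φ → Monotone ψ →
      0 ≤ ∑ s ∈ E₁.powerset.filter (fun s : Finset ι => z ∉ openCluster (ends '' (↑s : Set ι)) x ∧
            z ∉ openCluster (ends '' (↑(E₁ \ s) : Set ι)) x),
        (φ (openCluster (ends '' (↑s : Set ι)) x) - φ (openCluster (ends '' (↑(E₁ \ s) : Set ι)) x)) *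
          (ψ (openCluster (ends '' (↑s : Set ι)) x) - ψ (openCluster (ends '' (↑(E₁ \ s) : Set ι)) x)))
    (h₂ : ∀ φ ψ : Set V → ℝ, Monotone φ → Monotone ψ →
      0 ≤ ∑ s ∈ E₂.powerset.filter (fun s : Finset ι => z ∉ openCluster (ends '' (↑s : Set ι)) x ∧
            z ∉ openCluster (ends '' (↑(E₂ \ s) : Set ι)) x),
        (φ (openCluster (ends '' (↑s : Set ι)) x) - φ (openCluster (ends '' (↑(E₂ \ s) : Set ι)) x)) *
          (ψ (openCluster (ends '' (↑s : Set ι)) x) - ψ (openCluster (ends '' (↑(E₂ \ s) : Set ι)) x)))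
    (f g : Set V → ℝ) (hf : Monotone f) (hg : Monotone g) :
    0 ≤ ∑ s ∈ (E₁ ∪ E₂).powerset.filter (fun s : Finset ι => z ∉ openCluster (ends '' (↑s : Set ι)) x ∧
          z ∉ openCluster (ends '' (↑((E₁ ∪ E₂) \ s) : Set ι)) x),
      (f (openCluster (ends '' (↑s : Set ι)) x) - f (openCluster (ends '' (↑((E₁ ∪ E₂) \ s) : Set ι)) x)) *
        (g (openCluster (ends '' (↑s : Set ι)) x) - g (openCluster (ends '' (↑((E₁ ∪ E₂) \ s) : Set ι)) x)) := by
  set K : Finset ι → Set V := fun s => openCluster (ends '' (↑s : Set ι)) x with hK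
  change 0 ≤ ∑ s ∈ (E₁ ∪ E₂).powerset.filter (fun s => z ∉ K s ∧ z ∉ K ((E₁ ∪ E₂) \ s)),
      (f (K s) - f (K ((E₁ ∪ E₂) \ s))) * (g (K s) - g (K ((E₁ ∪ E₂) \ s)))
  set S₁ : Finset (Finset ι) := E₁.powerset.filter (fun s => z ∉ K s ∧ z ∉ K (E₁ \ s)) with hS₁
  set S₂ : Finset (Finset ι) := E₂.powerset.filter (fun s => z ∉ K s ∧ z ∉ K (E₂ \ s)) with hS₂
  have h₁' : ∀ φ ψ : Set V → ℝ, Monotone φ → Monotone ψ →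
      0 ≤ ∑ s ∈ S₁, (φ (K s) - φ (K (E₁ \ s))) * (ψ (K s) - ψ (K (E₁ \ s))) := h₁
  have h₂' : ∀ φ ψ : Set V → ℝ, Monotone φ → Monotone ψ →
      0 ≤ ∑ s ∈ S₂, (φ (K s) - φ (K (E₂ \ s))) * (ψ (K s) - ψ (K (E₂ \ s))) := h₂
  have hKmono : ∀ {s t : Finset ι}, s ⊆ t → K s ⊆ K t := fun hst => openCluster_image_mono ends hst x
  -- asymmetric forms on each piece
  have A₁ : ∀ φ ψ : Set V → ℝ, Monotone φ → Monotone ψ →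
      0 ≤ ∑ s ∈ S₁, φ (K s) * (ψ (K s) - ψ (K (E₁ \ s))) ∧ 0 ≤ ∑ s ∈ S₁, φ (K (E₁ \ s)) * (ψ (K (E₁ \ s)) - ψ (K s)) :=
    fun φ ψ hφ hψ => cwpa_asymm ends E₁ x z h₁ φ ψ hφ hψ
  have A₂ : ∀ φ ψ : Set V → ℝ, Monotone φ → Monotone ψ →
      0 ≤ ∑ s ∈ S₂, φ (K s) * (ψ (K s) - ψ (K (E₂ \ s))) ∧ 0 ≤ ∑ s ∈ S₂, φ (K (E₂ \ s)) * (ψ (K (E₂ \ s)) - ψ (K s)) :=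
    fun φ ψ hφ hψ => cwpa_asymm ends E₂ x z h₂ φ ψ hφ hψ
  -- cluster decomposition under parallel gluing (valid under the wall)
  have hsep' : ∀ s₁ s₂ : Finset ι, s₁ ⊆ E₁ → s₂ ⊆ E₂ →
      ∀ e ∈ s₁, ∀ e' ∈ s₂, ∀ w : V, w ∈ ends e → w ∈ ends e' → w = x ∨ w = z :=
    fun s₁ s₂ hs₁ hs₂ e he e' he' w hw hw' => hsep e (hs₁ he) e' (hs₂ he') w hw hw'
  have decomp : ∀ s₁ s₂ : Finset ι, s₁ ⊆ E₁ → s₂ ⊆ E₂ → z ∉ K s₁ → z ∉ K s₂ → K (s₁ ∪ s₂) = K s₁ ∪ K s₂ := by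
    intro s₁ s₂ hs₁ hs₂ hz1 hz2
    ext y
    rw [Set.mem_union]
    exact mem_openCluster_union_parallel ends (hsep' s₁ s₂ hs₁ hs₂) hz1 hz2 y
  have wall_iff : ∀ s₁ s₂ : Finset ι, s₁ ⊆ E₁ → s₂ ⊆ E₂ → (z ∉ K (s₁ ∪ s₂) ↔ z ∉ K s₁ ∧ z ∉ K s₂) := by
    intro s₁ s₂ hs₁ hs₂
    constructor
    · intro hz12
      exact ⟨fun h' => hz12 (hKmono Finset.subset_union_left h'), fun h' => hz12 (hKmono Finset.subset_union_right h')⟩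
    · rintro ⟨hz1, hz2⟩
      rw [decomp s₁ s₂ hs₁ hs₂ hz1 hz2, Set.mem_union, not_or]
      exact ⟨hz1, hz2⟩
  -- double sum
  simp only [Finset.sum_filter]
  rw [DualBHK.sum_powerset_union hE]
  have hsummand : ∀ s₁ ∈ E₁.powerset, ∀ s₂ ∈ E₂.powerset,
      (if z ∉ K (s₁ ∪ s₂) ∧ z ∉ K ((E₁ ∪ E₂) \ (s₁ ∪ s₂))
        then (f (K (s₁ ∪ s₂)) - f (K ((E₁ ∪ E₂) \ (s₁ ∪ s₂)))) *
          (g (K (s₁ ∪ s₂)) - g (K ((E₁ ∪ E₂) \ (s₁ ∪ s₂)))) else 0)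
      = (if z ∉ K s₁ ∧ z ∉ K (E₁ \ s₁) then
          (if z ∉ K s₂ ∧ z ∉ K (E₂ \ s₂) then
            (f (K s₁ ∪ K s₂) - f (K (E₁ \ s₁) ∪ K (E₂ \ s₂))) * (g (K s₁ ∪ K s₂) - g (K (E₁ \ s₁) ∪ K (E₂ \ s₂)))
          else 0) else 0) := by
    intro s₁ hs₁ s₂ hs₂
    have hs₁' := Finset.mem_powerset.mp hs₁
    have hs₂' := Finset.mem_powerset.mp hs₂
    rw [union_sdiff_union_of_subset hE hs₁' hs₂']
    have w1 := wall_iff s₁ s₂ hs₁' hs₂'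
    have w2 := wall_iff (E₁ \ s₁) (E₂ \ s₂) Finset.sdiff_subset Finset.sdiff_subset
    by_cases ha : z ∉ K s₁ ∧ z ∉ K (E₁ \ s₁)
    · by_cases hb : z ∉ K s₂ ∧ z ∉ K (E₂ \ s₂)
      · rw [if_pos ha, if_pos hb, if_pos ⟨w1.mpr ⟨ha.1, hb.1⟩, w2.mpr ⟨ha.2, hb.2⟩⟩,
          decomp s₁ s₂ hs₁' hs₂' ha.1 hb.1, decomp (E₁ \ s₁) (E₂ \ s₂) Finset.sdiff_subset Finset.sdiff_subset ha.2 hb.2]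
      · rw [if_pos ha, if_neg hb, if_neg]
        intro hc
        exact hb ⟨(w1.mp hc.1).2, (w2.mp hc.2).2⟩
    · rw [if_neg ha, if_neg]
      intro hc
      exact ha ⟨(w1.mp hc.1).1, (w2.mp hc.2).1⟩
  rw [Finset.sum_congr rfl fun s₁ hs₁ => Finset.sum_congr rfl fun s₂ hs₂ => hsummand s₁ hs₁ s₂ hs₂]
  have pull : ∀ s₁ ∈ E₁.powerset,
      ∑ s₂ ∈ E₂.powerset, (if z ∉ K s₁ ∧ z ∉ K (E₁ \ s₁) then
          (if z ∉ K s₂ ∧ z ∉ K (E₂ \ s₂) then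
            (f (K s₁ ∪ K s₂) - f (K (E₁ \ s₁) ∪ K (E₂ \ s₂))) * (g (K s₁ ∪ K s₂) - g (K (E₁ \ s₁) ∪ K (E₂ \ s₂)))
          else 0) else 0)
      = if z ∉ K s₁ ∧ z ∉ K (E₁ \ s₁) then
          ∑ s₂ ∈ S₂, (f (K s₁ ∪ K s₂) - f (K (E₁ \ s₁) ∪ K (E₂ \ s₂))) * (g (K s₁ ∪ K s₂) - g (K (E₁ \ s₁) ∪ K (E₂ \ s₂)))
        else 0 := by
    intro s₁ _
    by_cases ha : z ∉ K s₁ ∧ z ∉ K (E₁ \ s₁)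
    · simp only [if_pos ha]
      rw [hS₂, Finset.sum_filter]
    · simp only [if_neg ha, Finset.sum_const_zero]
  rw [Finset.sum_congr rfl pull, ← Finset.sum_filter]
  change 0 ≤ ∑ s₁ ∈ S₁, ∑ s₂ ∈ S₂,
    (f (K s₁ ∪ K s₂) - f (K (E₁ \ s₁) ∪ K (E₂ \ s₂))) * (g (K s₁ ∪ K s₂) - g (K (E₁ \ s₁) ∪ K (E₂ \ s₂)))
  -- four-term expansion
  have expand : ∀ s₁ s₂ : Finset ι,
      (f (K s₁ ∪ K s₂) - f (K (E₁ \ s₁) ∪ K (E₂ \ s₂))) * (g (K s₁ ∪ K s₂) - g (K (E₁ \ s₁) ∪ K (E₂ \ s₂)))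
      = f (K s₁ ∪ K s₂) * (g (K s₁ ∪ K s₂) - g (K (E₁ \ s₁) ∪ K s₂))
        + f (K s₁ ∪ K s₂) * (g (K (E₁ \ s₁) ∪ K s₂) - g (K (E₁ \ s₁) ∪ K (E₂ \ s₂)))
        + f (K (E₁ \ s₁) ∪ K (E₂ \ s₂)) * (g (K (E₁ \ s₁) ∪ K (E₂ \ s₂)) - g (K s₁ ∪ K (E₂ \ s₂)))
        + f (K (E₁ \ s₁) ∪ K (E₂ \ s₂)) * (g (K s₁ ∪ K (E₂ \ s₂)) - g (K s₁ ∪ K s₂)) := by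
    intro s₁ s₂; ring
  simp only [expand, Finset.sum_add_distrib]
  have mL : ∀ (φ : Set V → ℝ), Monotone φ → ∀ W : Set V, Monotone (fun X : Set V => φ (X ∪ W)) :=
    fun φ hφ W X X' hXX' => hφ (Set.union_subset_union_left W hXX')
  have mR : ∀ (φ : Set V → ℝ), Monotone φ → ∀ X : Set V, Monotone (fun W : Set V => φ (X ∪ W)) :=
    fun φ hφ X W W' hWW' => hφ (Set.union_subset_union_right X hWW')
  have T1 : 0 ≤ ∑ s₁ ∈ S₁, ∑ s₂ ∈ S₂, f (K s₁ ∪ K s₂) * (g (K s₁ ∪ K s₂) - g (K (E₁ \ s₁) ∪ K s₂)) := by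
    rw [Finset.sum_comm]
    exact Finset.sum_nonneg fun s₂ _ => (A₁ (fun X => f (X ∪ K s₂)) (fun X => g (X ∪ K s₂)) (mL f hf _) (mL g hg _)).1
  have T2 : 0 ≤ ∑ s₁ ∈ S₁, ∑ s₂ ∈ S₂, f (K s₁ ∪ K s₂) * (g (K (E₁ \ s₁) ∪ K s₂) - g (K (E₁ \ s₁) ∪ K (E₂ \ s₂))) :=
    Finset.sum_nonneg fun s₁ _ => (A₂ (fun W => f (K s₁ ∪ W)) (fun W => g (K (E₁ \ s₁) ∪ W)) (mR f hf _) (mR g hg _)).1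
  have T3 : 0 ≤ ∑ s₁ ∈ S₁, ∑ s₂ ∈ S₂,
      f (K (E₁ \ s₁) ∪ K (E₂ \ s₂)) * (g (K (E₁ \ s₁) ∪ K (E₂ \ s₂)) - g (K s₁ ∪ K (E₂ \ s₂))) := by
    rw [Finset.sum_comm]
    exact Finset.sum_nonneg fun s₂ _ =>
      (A₁ (fun X => f (X ∪ K (E₂ \ s₂))) (fun X => g (X ∪ K (E₂ \ s₂))) (mL f hf _) (mL g hg _)).2
  have T4 : 0 ≤ ∑ s₁ ∈ S₁, ∑ s₂ ∈ S₂, f (K (E₁ \ s₁) ∪ K (E₂ \ s₂)) * (g (K s₁ ∪ K (E₂ \ s₂)) - g (K s₁ ∪ K s₂)) :=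
    Finset.sum_nonneg fun s₁ _ => (A₂ (fun W => f (K (E₁ \ s₁) ∪ W)) (fun W => g (K s₁ ∪ W)) (mR f hf _) (mR g hg _)).2
  linarith

open Classical in
/-- **Base case: an `x–z` edge.**  If some edge of `E` joins `x ≠ z`, every colouring has a monochromatic `x–z` path, the wall is empty and the sum is `0`;
in particular a single edge `{e}` with ends `{x, z}` is in `𝒞`.  [cite: KozmaNitzan2024, Questions 8–9 (§5.5 p. 36) (context)] -/
theorem cwpa_of_adj (ends : ι → Sym2 V) (E : Finset ι) {x z : V} {e : ι} (he : e ∈ E) (hexz : ends e = s(x, z)) (hxz : x ≠ z)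
    (f g : Set V → ℝ) :
    0 ≤ ∑ s ∈ E.powerset.filter (fun s : Finset ι => z ∉ openCluster (ends '' (↑s : Set ι)) x ∧
          z ∉ openCluster (ends '' (↑(E \ s) : Set ι)) x),
      (f (openCluster (ends '' (↑s : Set ι)) x) - f (openCluster (ends '' (↑(E \ s) : Set ι)) x)) *
        (g (openCluster (ends '' (↑s : Set ι)) x) - g (openCluster (ends '' (↑(E \ s) : Set ι)) x)) := by
  have hreach : ∀ t : Finset ι, e ∈ t → z ∈ openCluster (ends '' (↑t : Set ι)) x := by
    intro t het
    have hadj : (openGraph (ends '' (↑t : Set ι))).Adj x z := by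
      rw [openGraph_image_adj]; exact ⟨⟨e, het, hexz⟩, hxz⟩
    exact hadj.reachable
  have hempty : E.powerset.filter (fun s : Finset ι => z ∉ openCluster (ends '' (↑s : Set ι)) x ∧
      z ∉ openCluster (ends '' (↑(E \ s) : Set ι)) x) = ∅ := by
    refine Finset.filter_eq_empty_iff.mpr fun s _ hs' => ?_
    by_cases hes : e ∈ s
    · exact hs'.1 (hreach s hes)
    · exact hs'.2 (hreach (E \ s) (Finset.mem_sdiff.mpr ⟨he, hes⟩))
  rw [hempty, Finset.sum_empty]

variable [Fintype ι]

open Classical in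
/-- **Base case: terminals not joined inside `E`.**  If `z` is not in the red cluster of `x` even when all of `E` is red, the wall is every colouring and
`(E; x, z) ∈ 𝒞` by the two-colouring Harris inequality on `E` (`harris_twoColouring_powerset`).  Covers `E = ∅` and disconnected pieces.
[cite: KozmaNitzan2024, Questions 8–9 (§5.5 p. 36) (context)] -/
theorem cwpa_of_not_mem_openCluster (ends : ι → Sym2 V) (E : Finset ι) {x z : V}
    (hz : z ∉ openCluster (ends '' (↑E : Set ι)) x) (f g : Set V → ℝ) (hf : Monotone f) (hg : Monotone g) :
    0 ≤ ∑ s ∈ E.powerset.filter (fun s : Finset ι => z ∉ openCluster (ends '' (↑s : Set ι)) x ∧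
          z ∉ openCluster (ends '' (↑(E \ s) : Set ι)) x),
      (f (openCluster (ends '' (↑s : Set ι)) x) - f (openCluster (ends '' (↑(E \ s) : Set ι)) x)) *
        (g (openCluster (ends '' (↑s : Set ι)) x) - g (openCluster (ends '' (↑(E \ s) : Set ι)) x)) := by
  set K : Finset ι → Set V := fun s => openCluster (ends '' (↑s : Set ι)) x with hK
  change 0 ≤ ∑ s ∈ E.powerset.filter (fun s => z ∉ K s ∧ z ∉ K (E \ s)), (f (K s) - f (K (E \ s))) * (g (K s) - g (K (E \ s)))
  have hKmono : ∀ {s t : Finset ι}, s ⊆ t → K s ⊆ K t := fun hst => openCluster_image_mono ends hst x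
  have hall : E.powerset.filter (fun s => z ∉ K s ∧ z ∉ K (E \ s)) = E.powerset := by
    refine Finset.filter_true_of_mem fun s hs => ?_
    exact ⟨fun h' => hz (hKmono (Finset.mem_powerset.mp hs) h'), fun h' => hz (hKmono Finset.sdiff_subset h')⟩
  rw [hall]
  exact harris_twoColouring_powerset E (fun s => f (K s)) (fun s => g (K s)) (fun s t hst => hf (hKmono hst))
    (fun s t hst => hg (hKmono hst))

open Classical in
/-- From the `E = univ` powerset form to the `sᶜ` form used by `Coefficientwise.cwpa_pendant_symm` and the gen-21/23 files.
[cite: KozmaNitzan2024, §5.5 (context only)] -/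
theorem cwpa_univ_of_powerset (ends : ι → Sym2 V) {x z : V} (f g : Set V → ℝ)
    (h : 0 ≤ ∑ s ∈ (univ : Finset ι).powerset.filter (fun s : Finset ι => z ∉ openCluster (ends '' (↑s : Set ι)) x ∧
          z ∉ openCluster (ends '' (↑(univ \ s) : Set ι)) x),
      (f (openCluster (ends '' (↑s : Set ι)) x) - f (openCluster (ends '' (↑(univ \ s) : Set ι)) x)) *
        (g (openCluster (ends '' (↑s : Set ι)) x) - g (openCluster (ends '' (↑(univ \ s) : Set ι)) x))) :
    0 ≤ ∑ s ∈ univ.filter (fun s : Finset ι => z ∉ openCluster (ends '' (↑s : Set ι)) x ∧ z ∉ openCluster (ends '' (↑(sᶜ) : Set ι)) x),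
      (f (openCluster (ends '' (↑s : Set ι)) x) - f (openCluster (ends '' (↑(sᶜ) : Set ι)) x)) *
        (g (openCluster (ends '' (↑s : Set ι)) x) - g (openCluster (ends '' (↑(sᶜ) : Set ι)) x)) := by
  simp only [Finset.powerset_univ, ← Finset.compl_eq_univ_sdiff] at h
  exact h

open Classical in
/-- From the `sᶜ` form (whole edge type) to the `E = univ` powerset form of this file (so that, e.g., gen 23's pendant theorem can be fed into the
composition theorems).  [cite: KozmaNitzan2024, §5.5 (context only)] -/
theorem cwpa_powerset_of_univ (ends : ι → Sym2 V) {x z : V} (f g : Set V → ℝ)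
    (h : 0 ≤ ∑ s ∈ univ.filter (fun s : Finset ι => z ∉ openCluster (ends '' (↑s : Set ι)) x ∧
          z ∉ openCluster (ends '' (↑(sᶜ) : Set ι)) x),
      (f (openCluster (ends '' (↑s : Set ι)) x) - f (openCluster (ends '' (↑(sᶜ) : Set ι)) x)) *
        (g (openCluster (ends '' (↑s : Set ι)) x) - g (openCluster (ends '' (↑(sᶜ) : Set ι)) x))) :
    0 ≤ ∑ s ∈ (univ : Finset ι).powerset.filter (fun s : Finset ι => z ∉ openCluster (ends '' (↑s : Set ι)) x ∧
          z ∉ openCluster (ends '' (↑(univ \ s) : Set ι)) x),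
      (f (openCluster (ends '' (↑s : Set ι)) x) - f (openCluster (ends '' (↑(univ \ s) : Set ι)) x)) *
        (g (openCluster (ends '' (↑s : Set ι)) x) - g (openCluster (ends '' (↑(univ \ s) : Set ι)) x)) := by
  simp only [Finset.powerset_univ, ← Finset.compl_eq_univ_sdiff]
  exact h

end Coefficientwise

end Summit.CriticalPhenomena.PercolationContinuityZ3.Theorems
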